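import Literature.NumberTheory.EllipticCurves.McCallum1991.HigherLevelKolyvaginClasses
import Summits.BirchSwinnertonDyer.BirchSwinnertonDyer.Theorems.ClassRecordThreeEulerHalvesAtThreeCoreVertex
import HarnessLib

/-!
# The Čebotarev input `h61` of the kernel Prop. 6.4 (`JET.Section6.exists_halfCoreVertex`) for a
# PAIR of opposite-sign eigenclasses at level `p^M`, from the typed McCallum 1991 Cor. 3.2
# (`McCallum1991.cor32_eigenclasses_infinite_primes_localOrder`, cell `bsd-jet`, seat lit-ty) — the
# S4 input of the JetchevMaxHL kernel line in the tree's currency (cell `bsd-stepL`, seat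
# `bsd-stepL-tam3-p1`, helper toward item 19109 `EulerHalvesAtThree`, stub `stub_jetchevMaxHLAtThree`)

HONEST FRAMING. CONDITIONAL on the named, unproved Literature fact
`McCallum1991.cor32_eigenclasses_infinite_primes_localOrder` (McCallum, LMS LN 153 (1991) §3
Cor. 3.2 at level `p^M` for `τ`-eigenclasses, p-adic tower image; typed 2026-08-27; at level `p` the
tree PROVES it: `McCallum1991_cor_3_2_eigen_holds`); nothing is discharged unconditionally; no item
closes; 0 classes move (T7); `--supports stmt-BirchSwinnertonDyer-19109` (helper). WHAT IS PROVED: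
* `addOrderOf_map_eq_of_pow_smul_mem_ker_iff` — PURE ALGEBRA: if `x` has order `p^M` and
  `p^j • x ∈ ker f ↔ M ≤ j` for all `j` (the fact's conclusion with `N_i = M_i`) then
  `ord (f x) = ord x` — the shape `addOrderOf (loc ℓ x) = addOrderOf x` of the hypothesis `h61` of
  `JET.Section6.exists_halfCoreVertex` (p484455) and of p471669's Thm. 6.3.
* `addOrderOf_dvd_of_eigen_opposite` — PURE ALGEBRA: two eigenclasses of OPPOSITE signs of an
  additive endomorphism, of odd order, are independent in McCallum's sense (`a•x + b•y = 0 ⟹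
  ord x ∣ a ∧ ord y ∣ b`; apply `τ`, add ∕ subtract: `2ea•x = 0 = 2eb•y`). This is WHY Jetchev's
  Lemma 6.1 (printed Lemma 5.1: «since `κ⁺` and `κ⁻` are linearly independent») is a special case
  of Cor. 3.2.
* `exists_kolyvaginPrime_pair_of_cor32` — the PAIR FORM of Cor. 3.2 at level `p^M` over the tree
  objects (`galH1Torsion (W.baseChange K) (p^M)`, `conjAct W c`, `Zhang2014.IsKolyvaginPrime ∕
  kolyvaginIndex`, `WeierstrassCurve.torsionLocalKer`): for `x` in the `e`-eigenspace and `y ≠ 0` in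
  the `−e`-eigenspace (orders `p^{M_x}`, `p^{M_y}`) and any finite set of primes `n` to avoid, a
  Kolyvagin prime `ℓ ∉ n` of index `≥ M` at which both classes keep their orders in the fact's kernel
  currency (`∀ v ∣ ℓ, ∀ j, p^j • x ∈ torsionLocalKer v ↔ M_x ≤ j`, same for `y`); `x = 0` allowed
  (then `r = 1`). With the first lemma this is exactly `h61` («`ℓ` avoiding `n`; orders of `loc x`,
  `loc y` preserved») once the instantiation supplies the localisation homomorphism whose kernel is
  `torsionLocalKer` (S1∕S2 of the `bsd-jet` sheet `PV2-J6-KERNEL.md`).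
* §3 (appended) `addOrderOf_map_eq_of_pow_smul_mem_ker_iff_iff` — PURE ALGEBRA: for `p^M`-torsion
  `x, y` with `p^j • x ∈ ker f ↔ p^j • y ∈ ker f` for all `j` (the conclusion shape of the typed
  McCallum Prop. 4.4 «in particular», `McCallum1991.prop44_localOrder_kolyvaginClass_mul_eq`),
  `ord (f x) = ord (f y)` — the shape `h47` of `exists_halfCoreVertex` (Jetchev Prop. 4.7).
References (locators only; the fact is imported): [cite: McCallumLMS1991, §3 Cor. 3.2 and the
definition of independence (p. 299); §4 Prop. 4.4 (p. 301)] [cite: Jetchev2008, Lemma 6.1 (arXiv p0015 L10–L25) =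
printed Lemma 5.1 (p. 821)]. Design: theorems only. Axioms: `propext`, `Classical.choice`,
`Quot.sound`.
-/

set_option autoImplicit false

noncomputable section

open scoped Classical NumberField

namespace Summit.BirchSwinnertonDyer.Rank1Residual.X11b.Three.Koly

open WeierstrassCurve Literature.NumberTheory.EllipticCurves IsDedekindDomain

universe u

/-! ### §1 Two pure-algebra lemmas -/

/-- **Orders preserved, read off a kernel**: if `x` has order `p^M` and `p^j • x ∈ ker f ↔ M ≤ j`
for every `j` (the conclusion shape of McCallum's Cor. 3.2 with `N_i = M_i`), then `f x` has order
`p^M = ord x` (the hypothesis shape `addOrderOf (loc x) = addOrderOf x` of `exists_halfCoreVertex`).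
[folklore] -/
theorem addOrderOf_map_eq_of_pow_smul_mem_ker_iff {G L : Type*} [AddCommGroup G] [AddCommGroup L]
    (f : G →+ L) {p M : ℕ} (hp : p.Prime) {x : G} (hx : addOrderOf x = p ^ M)
    (h : ∀ j : ℕ, ((p ^ j : ℕ) : ℤ) • x ∈ f.ker ↔ M ≤ j) :
    addOrderOf (f x) = addOrderOf x := by
  rw [hx]
  have hdvd : addOrderOf (f x) ∣ p ^ M := hx ▸ addOrderOf_map_dvd f x
  obtain ⟨a, ha, hfa⟩ := (Nat.dvd_prime_pow hp).mp hdvd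
  rw [hfa]
  have hmem : ((p ^ a : ℕ) : ℤ) • x ∈ f.ker := by
    rw [AddMonoidHom.mem_ker, map_zsmul, natCast_zsmul, ← hfa, addOrderOf_nsmul_eq_zero]
  have hMa : M ≤ a := (h a).mp hmem
  rw [le_antisymm ha hMa]

/-- **Two eigenclasses of opposite signs are independent** (McCallum's hypothesis in Cor. 3.2, for
`r = 2`): if `τ x = e•x`, `τ y = −e•y` (`e = ±1`) for an additive endomorphism `τ` and `x`, `y` have
ODD (finite) order, then `a•x + b•y = 0` forces `ord x ∣ a` and `ord y ∣ b`. (Apply `τ` and add ∕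
subtract: `2ea•x = 0 = 2eb•y`.) [cite: McCallumLMS1991, §3 Cor. 3.2, definition of independence (p. 299)] -/
theorem addOrderOf_dvd_of_eigen_opposite {G : Type*} [AddCommGroup G] (τ : G →+ G) {x y : G}
    {e : ℤ} (he : e = 1 ∨ e = -1) (hx : τ x = e • x) (hy : τ y = -e • y)
    (hox : Odd (addOrderOf x)) (hoy : Odd (addOrderOf y)) (a b : ℤ) (h : a • x + b • y = 0) :
    (addOrderOf x : ℤ) ∣ a ∧ (addOrderOf y : ℤ) ∣ b := by
  have he2 : e * e = 1 := by rcases he with rfl | rfl <;> norm_num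
  -- apply `τ`
  have h1 : (a * e) • x - (b * e) • y = 0 := by
    have := congrArg τ h
    rw [map_add, map_zsmul, map_zsmul, hx, hy, map_zero, smul_smul, smul_smul] at this
    rw [sub_eq_add_neg, ← neg_zsmul]
    convert this using 2
    ring_nf
  have h2 : (a * e) • x + (b * e) • y = 0 := by
    have := congrArg (fun z => e • z) h
    simp only [smul_add, smul_smul, smul_zero] at this
    rw [mul_comm e a, mul_comm e b] at this
    exact this
  have hx2 : (2 * e * a) • x = 0 := by
    have := congrArg₂ (· + ·) h1 h2
    simp only [sub_add_add_cancel, add_zero] at this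
    rw [← two_zsmul, smul_smul] at this
    convert this using 2; ring
  have hy2 : (2 * e * b) • y = 0 := by
    have := congrArg₂ (fun u v => v - u) h1 h2
    simp only [add_sub_sub_cancel, sub_zero] at this
    rw [← two_zsmul, smul_smul] at this
    convert this using 2; ring
  have hcop : ∀ {n : ℕ}, Odd n → ∀ c : ℤ, (n : ℤ) ∣ 2 * e * c → (n : ℤ) ∣ c := by
    intro n hn c hc
    have h2c : IsCoprime (n : ℤ) 2 := by
      rw [Int.isCoprime_iff_gcd_eq_one]
      obtain ⟨k, rfl⟩ := hn
      rw [Int.gcd_comm]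
      have : Int.gcd 2 (2 * (k : ℤ) + 1) = Int.gcd 2 1 := by
        rw [Int.gcd_comm, show (2 : ℤ) * k + 1 = 1 + 2 * k by ring, Int.gcd_comm]
        simp
      push_cast
      simp [this]
    have hec : (n : ℤ) ∣ e * c := by
      rw [mul_assoc] at hc
      exact h2c.dvd_of_dvd_mul_left hc
    rcases he with rfl | rfl
    · rw [one_mul] at hec; exact hec
    · rw [neg_one_mul] at hec; exact (dvd_neg).mp hec
  exact ⟨hcop hox a ((addOrderOf_dvd_iff_zsmul_eq_zero).mpr hx2),
    hcop hoy b ((addOrderOf_dvd_iff_zsmul_eq_zero).mpr hy2)⟩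


/-! ### §2 The PAIR form of McCallum's Cor. 3.2 at level `p^M` — the `h61` supply of the walk -/

/-- **Lemma 6.1 of Jetchev 2008 at level `p^M`, pair form, from the typed McCallum 1991 Cor. 3.2.**
For a class `x` in the `e`-eigenspace and a NON-ZERO class `y` in the `−e`-eigenspace of complex
conjugation on `H¹(K, E[p^M])` (orders `p^{M_x}`, `p^{M_y}`) and any finite set `n` of primes to
avoid, there is a Kolyvagin prime `ℓ ∉ n` of index `≥ M` at which BOTH classes keep their orders,
in the kernel currency of the fact: `p^j • x ∈ ker(H¹(K) → H¹(K_v)) ↔ M_x ≤ j` (all `j`, `v ∣ ℓ`), same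
for `y` — convertible to `ord loc_v x = ord x` by `addOrderOf_map_eq_of_pow_smul_mem_ker_iff`. This
is the hypothesis `h61` of `JET.Section6.exists_halfCoreVertex` (and of p471669's Thm. 6.3) in the
tree's currency. PROOF: Cor. 3.2 with `r = 2` and the classes `(x, y)` — independent by
`addOrderOf_dvd_of_eigen_opposite` (`p` odd) — or with `r = 1` and `y` alone when `x = 0`; an infinite
set of primes avoids `n`. CONDITIONAL on the fact `McCallum1991.cor32_eigenclasses_infinite_primes_localOrder`.
[cite: McCallumLMS1991, §3 Cor. 3.2 (p. 299)] [cite: Jetchev2008, Lemma 6.1 (arXiv p0015) = printed Lemma 5.1 (p. 821)] -/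
theorem exists_kolyvaginPrime_pair_of_cor32
    (h32 : McCallum1991.cor32_eigenclasses_infinite_primes_localOrder)
    (N : ℕ) [NeZero N] (W : WeierstrassCurve ℚ) [W.IsElliptic] [W.IsGloballyMinimal]
    (hcm : ¬ W.HasCM) (K : Type) [Field K] [NumberField K] (hK : IsImaginaryQuadratic K)
    (p : ℕ) (hp : p.Prime) (hp2 : p ≠ 2) (htower : ∀ n : ℕ, W.HasSurjectiveModNGaloisRep (p ^ n : ℕ))
    (c : K ≃ₐ[ℚ] K) (hc : c ≠ 1) (M : ℕ) (hM : 1 ≤ M)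
    (x y : galH1Torsion (W.baseChange K) ((p ^ M : ℕ) : ℤ)) (e : ℤ) (he : e = 1 ∨ e = -1)
    (hx : conjAct W c ((p ^ M : ℕ) : ℤ) x = e • x) (hy : conjAct W c ((p ^ M : ℕ) : ℤ) y = -e • y)
    (Mx My : ℕ) (hxo : addOrderOf x = p ^ Mx) (hyo : addOrderOf y = p ^ My) (hy0 : y ≠ 0)
    (n : Finset ℕ) :
    ∃ ℓ : ℕ, ℓ ∉ n ∧ Zhang2014.IsKolyvaginPrime N W K p ℓ ∧ M ≤ Zhang2014.kolyvaginIndex W p ℓ ∧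
      ∀ v : HeightOneSpectrum (𝓞 K), (ℓ : 𝓞 K) ∈ v.asIdeal →
        (∀ j : ℕ, ((p ^ j : ℕ) : ℤ) • x ∈
            (W.baseChange K).torsionLocalKer (v.adicCompletion K) ((p ^ M : ℕ) : ℤ) ↔ Mx ≤ j) ∧
        (∀ j : ℕ, ((p ^ j : ℕ) : ℤ) • y ∈
            (W.baseChange K).torsionLocalKer (v.adicCompletion K) ((p ^ M : ℕ) : ℤ) ↔ My ≤ j) := by
  have hme : -e = 1 ∨ -e = -1 := by rcases he with rfl | rfl <;> norm_num
  by_cases hx0 : x = 0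
  · -- `x = 0`: Cor. 3.2 with the single class `y`
    subst hx0
    have hMx : Mx = 0 := by
      rw [addOrderOf_zero] at hxo
      exact (Nat.pow_eq_one.mp hxo.symm).resolve_left hp.one_lt.ne' |> fun h => h
    have hS := h32 N W hcm K hK p hp hp2 htower c hc M hM 1 (fun _ => y) (fun _ => hy0)
      (fun _ => ⟨-e, hme, hy⟩)
      (fun a ha i => by
        have h0 : a 0 • y = 0 := by simpa using ha
        have : (addOrderOf y : ℤ) ∣ a 0 := (addOrderOf_dvd_iff_zsmul_eq_zero).mpr h0
        fin_cases i; exact this)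
      (fun _ => My) (fun _ => hyo) (fun _ => My) (fun _ => le_rfl)
    obtain ⟨ℓ, hℓS, hℓn⟩ := hS.exists_notMem_finset n
    obtain ⟨-, hkol, hidx, hloc⟩ := hℓS
    refine ⟨ℓ, hℓn, hkol, hidx, fun v hv => ⟨fun j => ?_, hloc 0 v hv⟩⟩
    rw [hMx, zsmul_zero]
    exact iff_of_true (AddSubgroup.zero_mem _) (Nat.zero_le j)
  · -- `x ≠ 0`: Cor. 3.2 with the pair `(x, y)`, independent because the signs are opposite
    have hodd : Odd p := hp.odd_of_ne_two hp2
    have hind : ∀ a : Fin 2 → ℤ, ∑ i, a i • (![x, y] i) = 0 → ∀ i, (addOrderOf (![x, y] i) : ℤ) ∣ a i := by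
      intro a ha
      rw [Fin.sum_univ_two] at ha
      simp only [Matrix.cons_val_zero, Matrix.cons_val_one] at ha
      have h := addOrderOf_dvd_of_eigen_opposite (conjAct W c ((p ^ M : ℕ) : ℤ)) he hx hy
        (hxo ▸ hodd.pow) (hyo ▸ hodd.pow) (a 0) (a 1) ha
      intro i
      fin_cases i
      · simpa using h.1
      · simpa using h.2
    have hS := h32 N W hcm K hK p hp hp2 htower c hc M hM 2 ![x, y]
      (fun i => by fin_cases i <;> simpa)
      (fun i => by
        fin_cases i
        · exact ⟨e, he, by simpa using hx⟩
        · exact ⟨-e, hme, by simpa using hy⟩)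
      hind ![Mx, My]
      (fun i => by fin_cases i <;> simpa)
      ![Mx, My] (fun _ => le_rfl)
    obtain ⟨ℓ, hℓS, hℓn⟩ := hS.exists_notMem_finset n
    obtain ⟨-, hkol, hidx, hloc⟩ := hℓS
    refine ⟨ℓ, hℓn, hkol, hidx, fun v hv => ⟨fun j => ?_, fun j => ?_⟩⟩
    · simpa using hloc 0 v hv j
    · simpa using hloc 1 v hv j


/-! ### §3 The Prop. 4.7 ∕ 4.4 input `h47` in the tree's currency (APPEND, same session) -/

/-- **Equal local orders, read off a kernel**: if `x` and `y` are `p^M`-torsion and, for every `j`,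
`p^j • x ∈ ker f ↔ p^j • y ∈ ker f` — the conclusion shape of the typed McCallum 1991 Prop. 4.4 «in
particular» (`McCallum1991.prop44_localOrder_kolyvaginClass_mul_eq`, second conjunct:
`p^j c_M(mℓ) ∈ ker_v ↔ p^j c_M(m) ∈ ker_v`) — then `ord (f x) = ord (f y)`: the hypothesis shape
`h47 : addOrderOf (loc ℓ κ_{cnℓ}) = addOrderOf (loc ℓ κ_{cn})` of `JET.Section6.exists_halfCoreVertex`
(p484455) and of p471669's Thm. 6.3 (Jetchev Prop. 4.7 = printed Prop. 4.4). PURE ALGEBRA: both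
orders are powers of `p` dividing `p^M`, and `p^a` kills `f x` iff it kills `f y`.
[cite: McCallumLMS1991, §4 Prop. 4.4 "In particular" (p. 301)] [cite: Jetchev2008, Prop. 4.7 (arXiv p0011) = printed Prop. 4.4 (p. 821)] -/
theorem addOrderOf_map_eq_of_pow_smul_mem_ker_iff_iff {G L : Type*} [AddCommGroup G]
    [AddCommGroup L] (f : G →+ L) {p M : ℕ} (hp : p.Prime) {x y : G}
    (hx : ((p ^ M : ℕ) : ℤ) • x = 0) (hy : ((p ^ M : ℕ) : ℤ) • y = 0)
    (h : ∀ j : ℕ, ((p ^ j : ℕ) : ℤ) • x ∈ f.ker ↔ ((p ^ j : ℕ) : ℤ) • y ∈ f.ker) :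
    addOrderOf (f x) = addOrderOf (f y) := by
  -- `p^j` kills `f z` iff `p^j • z ∈ ker f`
  have hkill : ∀ (z : G) (j : ℕ), addOrderOf (f z) ∣ p ^ j ↔ ((p ^ j : ℕ) : ℤ) • z ∈ f.ker := by
    intro z j
    rw [addOrderOf_dvd_iff_nsmul_eq_zero, AddMonoidHom.mem_ker, map_zsmul, natCast_zsmul]
  -- both orders are powers of `p`
  have hxM : addOrderOf (f x) ∣ p ^ M := (hkill x M).mpr (by rw [AddMonoidHom.mem_ker, hx, map_zero])
  have hyM : addOrderOf (f y) ∣ p ^ M := (hkill y M).mpr (by rw [AddMonoidHom.mem_ker, hy, map_zero])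
  obtain ⟨a, -, ha⟩ := (Nat.dvd_prime_pow hp).mp hxM
  obtain ⟨b, -, hb⟩ := (Nat.dvd_prime_pow hp).mp hyM
  -- each divides the other
  have h1 : addOrderOf (f y) ∣ p ^ a := (hkill y a).mpr ((h a).mp ((hkill x a).mp (ha ▸ dvd_rfl)))
  have h2 : addOrderOf (f x) ∣ p ^ b := (hkill x b).mpr ((h b).mpr ((hkill y b).mp (hb ▸ dvd_rfl)))
  rw [ha, hb] at *
  exact Nat.dvd_antisymm (by exact h2) (by exact h1)

end Summit.BirchSwinnertonDyer.Rank1Residual.X11b.Three.Koly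

end
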